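import Literature.Probability.Percolation.MarkedLoopTwoCellRing
import Literature.Probability.Percolation.MarkedLoopPendantTwoSingles
import Literature.Probability.Percolation.MarkedLoopPatternCapIns
import HarnessLib

/-!
# Two attached cells: the four presence profiles of the new bonds, and the two bijections (pendant cases, cap case) («TWO-CELL-PROFILE»)

Topic `Literature/Probability/Percolation`; generic-`k` layer of the marked-loop (Khristoforov–Smirnov) lineage; the combinatorial core of the lane's TWO-CELL CAP IDENTITY (HOME
`FINDING-TWO-CELL-CAP-IDENTITY.md` §2), on `MarkedLoopTwoCellRing.lean` («TWO-CELL-RING»: `TwoCellData`, the junction identities, `mem_hBondsW_iff`, `mem_touchingW_iff`, `mem_cornersW_iff`,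
the parity walk `nbond₁_mem_iff` / `nbond₂_zero_mem_iff` / `nbond₂_mem_iff`), `MarkedLoopPendantTwoSingles.lean` (`TwoPendants`: two single-root pendants at once),
`MarkedLoopPendantRootless.lean` (rootless pendants, `odd_xiDeg_iff_three`), `MarkedLoopLawSlide.lean` §1–§2 (#848) and `MarkedLoopPatternCapIns.lean` (`Pat₀.capIns`, `mem_capIns_iff`,
`capIns_partner`).

By the parity walk the new-bond part of a configuration `ζ ∈ W^{W}_z(s)` is determined by the two bits `x = [nb¹_0 ∈ ζ]`, `y = [I ∈ ζ]`; this file names the resulting presence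
profile and proves, once for all four values of `(x, y)`, everything the count identity needs:

* §1 `TwoCellProfile N x y` — **THE PRESENCE PROFILE**: `N` consists of new bonds, `nb¹_k ∈ N ↔ (x ↔ k ≤ k₁)` (`k ≤ m₁`), `I ∈ N ↔ y`, `nb²_k ∈ N ↔ ((x ↔ y) ↔ k ≤ k₂)` (`k ≤ m₂`);
  ★ `TwoCellData.isProfile_filter` (the new-bond part of every configuration is a profile), `TwoCellProfile.eq_of_iff` (a profile is determined by its two bits),
  ★★ `TwoCellData.odd_xiDeg_N₁_iff` / `odd_xiDeg_N₂_iff` / `xiDeg_eq_zero_of_not_mem` — **THE SIDE COUNTS OF A PROFILE**: odd exactly at `a`, at `b`, at `P` iff `x`, at `c` iff `y`,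
  at `Q` iff `¬ (x ↔ y)`; `odd_xiDeg_iff_of_touching`;
* §2 `TwoCellMarks D E ja jb j R₁ R₂` — the small domain marked additionally at two ROOT faces `R₁, R₂` at the indices `ja, jb` of `a, b`; `PendantCase` — **A PENDANT CASE**
  (`(x, y) ≠ (⊥, ⊥)`): a profile `N = E₁ ⊔ E₂` made of two single-root pendants, `E₁ ∋ a` rooted at `R₁` and `E₂ ∋ b` rooted at `R₂`, where the roots are the odd touching faces
  of the profile; for a pendant case: ★★ `parityIs_union_iff`, ★★ `union_mem_TXb_iff` (`ξ ∪ N ∈ W^{W}_z(s) ↔ ξ ∈ W^{E}_z(s)`), ★ `inClassX_union_iff`, ★ `linkRel_union_eq` (same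
  partner, same link relation — `a ↦ R₁`, `b ↦ R₂` is the identity on indices), `eq_filter_union`, ★★★ `card_filter_case_eq` (the class counts correspond);
* §3 `CapCase` — **THE CAP CASE** (`x = y = ⊥`): a profile `N` that is ONE rootless path joining `a` to `b` through outer faces; for it: ★★ `union_mem_TXb_iff₀`
  (`ξ ∪ N ∈ W^{W}_z(s) ↔ ξ ∈ W^{D}_z(s)`), ★★★ `inClassX_union_iff₀` / `linkRel_union_eq₀` — the pattern of `ξ ∪ N` is the CAP INSERTION `q.capIns j` of the pattern `q` of `ξ`,
  ★★★ `card_filter_cap_eq_sum` (the class count is the sum over the cap-insertion fibre).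

The three pendant cases `(P, Q)`, `(P, c)`, `(c, Q)` and the cap case are instantiated, and the identity assembled, in the sequel «LAW-TWO-CELL-CAP».

## References
* M. Khristoforov, S. Smirnov, *Percolation and O(1) loop model*, arXiv:2111.15612v1 (2021), §1.2 (p. 2: loop configurations with boundary disorders, «IP(ξ) is a union of
  disjoint paths, matching marked points», the law of the link pattern), §2 Definition 3 (p. 4: the events `z ↔ u_j`).
* P. A. Pearce, V. Rittenberg, J. de Gier, B. Nienhuis, *Temperley–Lieb stochastic processes*, J. Phys. A 35 (2002) L661–L668, §2 ((monoid): the cup–cap `e_j`; link patterns).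
* B. Bollobás, O. Riordan, *Percolation*, Cambridge University Press 2006, Ch. 7 §7.2.2 pp. 168–169 (discrete domains; attaching hexagons; marked sites).

## Mathlib / tree
Tree: `MarkedLoopTwoCellRing` (all of it), `MarkedLoopLawSlide` (`nbond`, `side_N_idx*`, `side_N_eq_or`, `odd_xiDeg_iff_not_iff`, `eq_N_or_of_inc`, `side_ne_nbond_of_not_mem`,
`exists_eq_N_of_mem`, `N_inj`, `xiDeg_union_of_disjoint`, `reachable_union_pendant(_root)`, `SlideData.EQ`), `MarkedLoopLawContract` (`EN`, `exists_pat₀_of_mem_TXb`,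
`pat₀_unique_of_mem_TXb`), `MarkedLoopPendantTwoSingles` (`TwoPendants.*`), `MarkedLoopPendantRootless` (`reachable_union_rootless(_inner)`, `not_reachable_union_rootless`,
`odd_xiDeg_iff_three`), `MarkedLoopPatternCapIns` (`Pat₀.capIns`, `mem_capIns_iff`, `capIns_partner`, `capIns_injective`), `KhSThreeDisorderObservable` (`TXb`, `mem_TXb_iff`,
`ParityIs`, `InClassX`, `hbK_inClassX_iff`), `KhSThreeDisorderNormalisation` (`existsUnique_inClassX`), `MarkedLoopSpace`, `MarkedLoopHolomorphy` (`mem_linkRel`,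
`hBonds_eq_of_verts_eq'`), `MarkedLoopTripodBasis` (`Pat₀`, `IsPattern.symm/irrefl/partner_eq`), `MarkedLoopBoundarySpan` (`ArcPoint`), `LatticeModels/TemperleyLiebCapContract`
(`skip`, `skip_injective`). Mathlib: `Finset.card_bij`, `Finset.card_biUnion`, `Finset.filter_union_filter_not_eq`, `Nat.odd_add`.
-/

open Finset

namespace Literature.Probability.Percolation.MarkedLoops

open Literature.Probability.Percolation Literature.Probability.LatticeModels
open Literature.Probability.LatticeModels.TemperleyLieb
open Literature.Probability.Percolation.FivePoint (side side_injective XiLinked Inc inc_side inc_mk_iff xiDeg)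
open Literature.Probability.Percolation.FivePoint.N5 (sideGraph side_oppFace_oppIdx xiLinked_iff_reachable l1_xiDeg_eq ht2_sideGraph_mono)
open TriMarkedDomain

/-! ## §1 Presence profiles of the new bonds -/

section Profile

variable {nm : ℕ}

/-- **A PRESENCE PROFILE OF THE NEW BONDS with bits `x`, `y`**: `N` consists of new bonds; along `h₁` the bonds `nb¹_k`, `k ≤ m₁`, are present iff `x ↔ k ≤ k₁` (one flip at `a`);
the interior bond `I = nb¹_{m₁+1}` is present iff `y`; along `h₂` the bonds `nb²_k`, `k ≤ m₂`, are present iff `(x ↔ y) ↔ k ≤ k₂` (the junction rule, then one flip at `b`).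
[cite: KhristoforovSmirnov2021, §1.2 (arXiv v1 pp. 2–3: loop configurations with prescribed disorders); lane tool notion] -/
structure TwoCellProfile (h₁ h₂ : Site 2) (r₁ m₁ k₁ r₂ m₂ k₂ : Fin 6) (N : Finset (Sym2 (Site 2))) (x y : Prop) : Prop where
  /-- the bonds are new bonds -/
  sub : ∀ b ∈ N, (∃ k : Fin 6, k ≤ m₁ + 1 ∧ b = nbond h₁ (r₁ + k)) ∨ (∃ k : Fin 6, k ≤ m₂ ∧ b = nbond h₂ (r₂ + k))
  /-- along `h₁`: one flip at `a` -/
  mem₁ : ∀ k : Fin 6, k ≤ m₁ → (nbond h₁ (r₁ + k) ∈ N ↔ (x ↔ k ≤ k₁))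
  /-- the interior bond -/
  memI : nbond h₁ (r₁ + (m₁ + 1)) ∈ N ↔ y
  /-- along `h₂`: the junction rule, then one flip at `b` -/
  mem₂ : ∀ k : Fin 6, k ≤ m₂ → (nbond h₂ (r₂ + k) ∈ N ↔ ((x ↔ y) ↔ k ≤ k₂))

namespace TwoCellProfile

variable {h₁ h₂ : Site 2} {r₁ m₁ k₁ r₂ m₂ k₂ : Fin 6} {N N' : Finset (Sym2 (Site 2))} {x y x' y' : Prop}

/-- ★ **a profile is determined by its two bits.** [cite: KhristoforovSmirnov2021, §1.2 (arXiv v1 pp. 2–3)] -/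
theorem eq_of_iff (P : TwoCellProfile h₁ h₂ r₁ m₁ k₁ r₂ m₂ k₂ N x y) (P' : TwoCellProfile h₁ h₂ r₁ m₁ k₁ r₂ m₂ k₂ N' x' y') (hm₁ : m₁.val ≤ 3) (hx : x ↔ x') (hy : y ↔ y') :
    N = N' := by
  have key : ∀ b, ((∃ k : Fin 6, k ≤ m₁ + 1 ∧ b = nbond h₁ (r₁ + k)) ∨ (∃ k : Fin 6, k ≤ m₂ ∧ b = nbond h₂ (r₂ + k))) → (b ∈ N ↔ b ∈ N') := by
    rintro b (⟨k, hk, rfl⟩ | ⟨k, hk, rfl⟩)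
    · rcases (show k ≤ m₁ ∨ k = m₁ + 1 by omega) with hk' | rfl
      · rw [P.mem₁ k hk', P'.mem₁ k hk', hx]
      · rw [P.memI, P'.memI, hy]
    · rw [P.mem₂ k hk, P'.mem₂ k hk, hx, hy]
  ext b
  exact ⟨fun hb => (key b (P.sub b hb)).1 hb, fun hb => (key b (P'.sub b hb)).2 hb⟩

/-- every bond of a profile is an `nbond` of `h₁` or of `h₂`. [cite: KhristoforovSmirnov2021, §1.2 (arXiv v1 p. 2)] -/
theorem exists_eq_nbond (P : TwoCellProfile h₁ h₂ r₁ m₁ k₁ r₂ m₂ k₂ N x y) {b : Sym2 (Site 2)} (hb : b ∈ N) : (∃ l, b = nbond h₁ l) ∨ ∃ l, b = nbond h₂ l := by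
  rcases P.sub b hb with ⟨k, -, rfl⟩ | ⟨k, -, rfl⟩
  · exact Or.inl ⟨_, rfl⟩
  · exact Or.inr ⟨_, rfl⟩

end TwoCellProfile

namespace TwoCellData

variable {W : TriMarkedDomain (nm + 1 + 1)} {D : TriMarkedDomain nm} {h₁ h₂ : Site 2} {r₁ m₁ k₁ r₂ m₂ k₂ : Fin 6} {ja jb : Fin (nm + 1 + 1)} {j : Fin (nm + 1)}
  (T : TwoCellData W D h₁ h₂ r₁ m₁ k₁ r₂ m₂ k₂ ja jb j)
include T

/-! ### `Fin 3` bookkeeping -/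

omit T in
/-- `Fin 3` bookkeeping. [folklore] -/
private theorem fin3_facts (a : Fin 3) : a + 1 + 1 = a + 2 ∧ a + 1 + 2 = a ∧ a + 2 + 1 = a ∧ a + 2 + 2 = a + 1 := by
  revert a; decide

omit T in
/-- propositional bookkeeping of the one-flip step. [cite: KhristoforovSmirnov2021, §1.2 (arXiv v1 pp. 2–3); lane plumbing] -/
private theorem iff_flip (A B C : Prop) : (¬ ((A ↔ B) ↔ (A ↔ C))) ↔ ¬ (B ↔ C) := by
  tauto

omit T in
/-- propositional bookkeeping at the outer junction. [cite: KhristoforovSmirnov2021, §1.2 (arXiv v1 pp. 2–3); lane plumbing] -/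
private theorem prop_J {X Y A B : Prop} (hA : A) (hB : ¬ B) : ((X ↔ Y) ↔ A) ↔ ¬ (Y ↔ (X ↔ B)) := by
  tauto

/-! ### The new-bond part of a configuration is a profile -/

/-- ★ **THE NEW-BOND PART OF A CONFIGURATION IS A PROFILE** with bits `x = [nb¹_0 ∈ ζ]`, `y = [I ∈ ζ]` (the parity walk of «TWO-CELL-RING» §3).
[cite: KhristoforovSmirnov2021, §1.2 (arXiv v1 pp. 2–3: loop configurations with prescribed disorders)] -/
theorem isProfile_filter {v : HexVertex} {i : Fin 3} {s : HexVertex} (hs : s ∈ triFacesTouching D.verts) {ζ : Finset (Sym2 (Site 2))} (hζ : ζ ∈ TXb W v i s) :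
    TwoCellProfile h₁ h₂ r₁ m₁ k₁ r₂ m₂ k₂ (ζ.filter fun b => b ∉ hBonds D) (nbond h₁ r₁ ∈ ζ) (nbond h₁ (r₁ + (m₁ + 1)) ∈ ζ) := by
  classical
  have hsub : ζ ⊆ hBonds W := fun b hb => (Finset.mem_erase.1 (((mem_TXb_iff (D := W) v i s ζ).1 hζ).1 hb)).2
  have hm := T.m₁_le
  refine ⟨fun b hb => ?_, fun k hk => ?_, ?_, fun k hk => ?_⟩
  · rw [Finset.mem_filter] at hb
    exact (T.mem_hBondsW_iff.1 (hsub hb.1)).resolve_left hb.2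
  · rw [Finset.mem_filter, T.nbond₁_mem_iff hs hζ hk]
    exact ⟨fun h => h.1, fun h => ⟨h, T.new₁_not_mem_hBonds (by omega)⟩⟩
  · rw [Finset.mem_filter]
    exact ⟨fun h => h.1, fun h => ⟨h, T.I_not_mem_hBonds⟩⟩
  · rw [Finset.mem_filter, T.nbond₂_mem_iff hs hζ hk, T.nbond₂_zero_mem_iff hs hζ]
    exact ⟨fun h => h.1, fun h => ⟨h, T.new₂_not_mem_hBonds hk⟩⟩

omit T in
/-- a configuration is its `H_G`-part plus its new-bond part. [cite: KhristoforovSmirnov2021, §1.2 (arXiv v1 p. 2)] -/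
theorem eq_filter_union_filter (ζ : Finset (Sym2 (Site 2))) : ζ = ζ.filter (fun b => b ∈ hBonds D) ∪ ζ.filter (fun b => b ∉ hBonds D) := by
  classical
  exact (Finset.filter_union_filter_not_eq _ ζ).symm

/-! ### The side counts of a profile -/

section Parity

variable {N : Finset (Sym2 (Site 2))} {x y : Prop} (P : TwoCellProfile h₁ h₂ r₁ m₁ k₁ r₂ m₂ k₂ N x y)
include P

/-- a profile lies in `H_{G'}`. [cite: KhristoforovSmirnov2021, §1.2 (arXiv v1 p. 2)] -/
theorem profile_subset_hBondsW : N ⊆ hBonds W := by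
  intro b hb
  rcases P.sub b hb with ⟨k, -, rfl⟩ | ⟨k, -, rfl⟩
  · exact T.nbond₁_mem_hBondsW _
  · exact T.nbond₂_mem_hBondsW _

/-- a profile avoids `H_G`. [cite: KhristoforovSmirnov2021, §1.2 (arXiv v1 p. 2)] -/
theorem not_mem_profile_of_mem_hBonds {b : Sym2 (Site 2)} (hb : b ∈ hBonds D) : b ∉ N := by
  intro hbN
  rcases P.sub b hbN with ⟨k, hk, rfl⟩ | ⟨k, hk, rfl⟩
  · exact T.new₁_not_mem_hBonds hk hb
  · exact T.new₂_not_mem_hBonds hk hb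

/-- a profile is disjoint from every `ξ ⊆ H_G`. [cite: KhristoforovSmirnov2021, §1.2 (arXiv v1 p. 2)] -/
theorem disjoint_profile {ξ : Finset (Sym2 (Site 2))} (hξ : ξ ⊆ hBonds D) : Disjoint ξ N :=
  Finset.disjoint_left.2 fun _ hb hbN => T.not_mem_profile_of_mem_hBonds P (hξ hb) hbN

/-- a bond with an endpoint in `G` is not in a profile. [cite: KhristoforovSmirnov2021, §1.2 (arXiv v1 p. 2)] -/
theorem mk_not_mem_profile {u w : Site 2} (hadj : triGraph.Adj u w) (hG : u ∈ D.verts ∨ w ∈ D.verts) : s(u, w) ∉ N :=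
  T.not_mem_profile_of_mem_hBonds P (mem_hBonds D hadj hG)

omit T in
/-- the side count of a profile vanishes at a face containing neither `h₁` nor `h₂`. [cite: KhristoforovSmirnov2021, §1.2 (arXiv v1 p. 2)] -/
theorem xiDeg_eq_zero_of_not_mem {F : HexVertex} (hF₁ : h₁ ∉ hexFaceVertices F) (hF₂ : h₂ ∉ hexFaceVertices F) : xiDeg N F = 0 := by
  rw [l1_xiDeg_eq, Finset.card_eq_zero, Finset.filter_eq_empty_iff]
  intro l _ hl
  rcases P.exists_eq_nbond hl with ⟨l', e⟩ | ⟨l', e⟩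
  · exact side_ne_nbond_of_not_mem hF₁ l _ e
  · exact side_ne_nbond_of_not_mem hF₂ l _ e

/-- the side count vanishes at a face all of whose sides lie in `H_G`. [cite: KhristoforovSmirnov2021, §1.2 (arXiv v1 p. 2)] -/
theorem xiDeg_eq_zero_of_sides {F : HexVertex} (h : ∀ l : Fin 3, side F l ∈ hBonds D) : xiDeg N F = 0 := by
  rw [l1_xiDeg_eq, Finset.card_eq_zero, Finset.filter_eq_empty_iff]
  intro l _ hl
  exact T.not_mem_profile_of_mem_hBonds P (h l) hl

omit P in
/-- the three sides of a contact face of `h₁` (offset `k`, `m₁ + 1 < k ≠ 5`) lie in `H_G`. [cite: KhristoforovSmirnov2021, §1.2 (arXiv v1 p. 2)] -/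
theorem sides_N₁_mem_hBonds {k : Fin 6} (hk : m₁ + 1 < k) (hk5 : k ≠ 5) (l : Fin 3) : side (leftFaceDir h₁ (r₁ + k)) l ∈ hBonds D := by
  have hg : h₁ + triDir (r₁ + k) ∈ D.verts := T.in₁ k hk
  have hm := T.m₁_le
  rcases side_N_eq_or h₁ (r₁ + k) l with e | e | e
  · rw [e]; exact mem_hBonds D (by
      have := triGraph_adj_add_triDir (h₁ + triDir (r₁ + k)) (r₁ + k + 2)
      rwa [add_triDir_add_triDir_add_two'] at this) (Or.inl hg)
  · rw [e, add_assoc r₁ k 1]; unfold nbond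
    exact mem_hBonds D (triGraph_adj_add_triDir h₁ _) (Or.inr (T.in₁ (k + 1) (by omega)))
  · rw [e]; exact mem_hBonds D (triGraph_adj_add_triDir h₁ _) (Or.inr hg)

omit P in
/-- the three sides of a contact face of `h₂` (offset `k`, `m₂ < k`, `k ∉ {4, 5}`) lie in `H_G`. [cite: KhristoforovSmirnov2021, §1.2 (arXiv v1 p. 2)] -/
theorem sides_N₂_mem_hBonds {k : Fin 6} (hk : m₂ < k) (hk4 : k ≠ 4) (hk5 : k ≠ 5) (l : Fin 3) : side (leftFaceDir h₂ (r₂ + k)) l ∈ hBonds D := by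
  have hg : h₂ + triDir (r₂ + k) ∈ D.verts := T.in₂ k hk hk5
  rcases side_N_eq_or h₂ (r₂ + k) l with e | e | e
  · rw [e]; exact mem_hBonds D (by
      have := triGraph_adj_add_triDir (h₂ + triDir (r₂ + k)) (r₂ + k + 2)
      rwa [add_triDir_add_triDir_add_two'] at this) (Or.inl hg)
  · rw [e, add_assoc r₂ k 1]; unfold nbond
    exact mem_hBonds D (triGraph_adj_add_triDir h₂ _) (Or.inr (T.in₂ (k + 1) (by omega) (by omega)))
  · rw [e]; exact mem_hBonds D (triGraph_adj_add_triDir h₂ _) (Or.inr hg)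

/-- ★★ **THE SIDE COUNT OF A PROFILE AROUND `h₁`**: at `N¹_k` it is odd iff `k = k₁` (the corner `a`), or `k = 5` (the contact end `P`) and `x`, or `k = m₁ + 1` (the junction `c`)
and `y`. [cite: KhristoforovSmirnov2021, §1.2 (arXiv v1 pp. 2–3: loop configurations with prescribed disorders)] -/
theorem odd_xiDeg_N₁_iff (k : Fin 6) : Odd (xiDeg N (leftFaceDir h₁ (r₁ + k))) ↔ k = k₁ ∨ (k = 5 ∧ x) ∨ (k = m₁ + 1 ∧ y) := by
  have hNW := T.profile_subset_hBondsW P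
  have hm := T.m₁_le
  have h0 := T.k₁_lt
  have hm₂ := T.m₂_le
  have hsplit : k < m₁ ∨ m₁ = k ∨ m₁ + 1 = k ∨ (m₁ + 1 < k ∧ k ≠ 5) ∨ 5 = k := by omega
  rcases hsplit with hk | rfl | rfl | ⟨hk, hk5⟩ | rfl
  · -- an outer face of `h₁`: one flip, at `a`
    rw [odd_xiDeg_iff_not_iff (leftFaceIdx (r₁ + k)) (fun hm' => T.outer₁_not_mem_hBondsW hk (by rw [← side_N_idx]; exact hNW hm')), side_N_idx_add_one,
      side_N_idx_add_two, add_assoc r₁ k 1, P.mem₁ (k + 1) (by omega), P.mem₁ k hk.le, iff_flip]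
    constructor
    · intro h; exact Or.inl (by omega)
    · rintro (h | ⟨h, -⟩ | ⟨h, -⟩) <;> omega
  · -- the outer junction `J`: three new sides, always even
    have e1 : s(h₁ + triDir (r₁ + m₁), h₁ + triDir (r₁ + m₁ + 1)) = nbond h₂ (r₂ + 0) := by
      unfold nbond
      rw [add_zero, ← T.o_eq, add_assoc r₁ m₁ 1, ← T.h₂_eq, Sym2.eq_swap]
    rw [odd_xiDeg_iff_three N _ (leftFaceIdx (r₁ + m₁)), side_N_idx, side_N_idx_add_one, side_N_idx_add_two, e1, add_assoc r₁ m₁ 1, P.mem₂ 0 (Fin.zero_le _),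
      P.memI, P.mem₁ m₁ le_rfl]
    refine iff_of_false (fun h => h (prop_J (Fin.zero_le _) (by omega))) ?_
    rintro (h | ⟨h, -⟩ | ⟨h, -⟩) <;> omega
  · -- the inner junction `c`: the interior bond is its only new side
    have ha : side (leftFaceDir h₁ (r₁ + (m₁ + 1))) (leftFaceIdx (r₁ + (m₁ + 1)) + 1) ∉ N := by
      rw [side_N_idx_add_one, add_assoc r₁ (m₁ + 1) 1]; unfold nbond
      exact T.mk_not_mem_profile P (triGraph_adj_add_triDir h₁ _) (Or.inr (T.in₁ _ (by omega)))
    have hσ : side (leftFaceDir h₁ (r₁ + (m₁ + 1))) (leftFaceIdx (r₁ + (m₁ + 1))) ∉ N := by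
      rw [side_N_idx, ← T.h₂_eq, add_assoc r₁ (m₁ + 1) 1, show m₁ + 1 + 1 = m₁ + 2 by omega, ← T.s_eq]
      exact T.mk_not_mem_profile P (triGraph_adj_add_triDir h₂ _) (Or.inr (T.in₂ 4 (by omega) (by decide)))
    rw [odd_xiDeg_iff_not_iff (leftFaceIdx (r₁ + (m₁ + 1)) + 1) ha, (fin3_facts _).1, (fin3_facts _).2.1, side_N_idx_add_two, P.memI]
    constructor
    · intro h
      refine Or.inr (Or.inr ⟨rfl, ?_⟩)
      by_contra hy
      exact h ⟨fun h' => absurd h' hy, fun h' => absurd h' hσ⟩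
    · rintro (h | ⟨h, -⟩ | ⟨-, h⟩)
      · exfalso; omega
      · exfalso; omega
      · exact fun h' => hσ (h'.1 h)
  · -- a contact face of `h₁`: all sides in `H_G`
    rw [T.xiDeg_eq_zero_of_sides P (T.sides_N₁_mem_hBonds hk hk5)]
    refine iff_of_false (by decide) ?_
    rintro (h | ⟨h, -⟩ | ⟨h, -⟩) <;> omega
  · -- the contact end `P`: `nb¹_0` is its only new side
    have ha : side (leftFaceDir h₁ (r₁ + 5)) (leftFaceIdx (r₁ + 5) + 2) ∉ N := by
      rw [side_N_idx_add_two]; unfold nbond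
      exact T.mk_not_mem_profile P (triGraph_adj_add_triDir h₁ _) (Or.inr (T.in₁ 5 (by omega)))
    have hσ : side (leftFaceDir h₁ (r₁ + 5)) (leftFaceIdx (r₁ + 5)) ∉ N := by
      rw [side_N_idx]
      exact T.mk_not_mem_profile P (by
        have := triGraph_adj_add_triDir (h₁ + triDir (r₁ + 5)) (r₁ + 5 + 2)
        rwa [add_triDir_add_triDir_add_two'] at this) (Or.inl (T.in₁ 5 (by omega)))
    rw [odd_xiDeg_iff_not_iff (leftFaceIdx (r₁ + 5) + 2) ha, (fin3_facts _).2.2.1, (fin3_facts _).2.2.2, side_N_idx_add_one,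
      show r₁ + 5 + 1 = r₁ + 0 by omega, P.mem₁ 0 (Fin.zero_le _)]
    have e6 : (0 : Fin 6) ≤ k₁ := Fin.zero_le _
    constructor
    · intro h
      refine Or.inr (Or.inl ⟨rfl, ?_⟩)
      by_contra hx
      exact h ⟨fun h' => absurd h' hσ, fun h' => absurd (h'.2 e6) hx⟩
    · rintro (h | ⟨-, h⟩ | ⟨h, -⟩)
      · exfalso; omega
      · exact fun h' => hσ (h'.2 ⟨fun _ => e6, fun _ => h⟩)
      · exfalso; omega

/-- ★★ **THE SIDE COUNT OF A PROFILE AROUND `h₂`**: at `N²_k` it is odd iff `k = k₂` (the corner `b`), or `k = m₂` (the contact end `Q`) and `¬ (x ↔ y)`, or `k = 4` (the junction `c`)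
and `y`. [cite: KhristoforovSmirnov2021, §1.2 (arXiv v1 pp. 2–3: loop configurations with prescribed disorders)] -/
theorem odd_xiDeg_N₂_iff (k : Fin 6) : Odd (xiDeg N (leftFaceDir h₂ (r₂ + k))) ↔ k = k₂ ∨ (k = m₂ ∧ ¬ (x ↔ y)) ∨ (k = 4 ∧ y) := by
  have hNW := T.profile_subset_hBondsW P
  have hm := T.m₂_le
  have h0 := T.k₂_lt
  have hm₁ := T.m₁_le
  have h0₁ := T.k₁_lt
  have hsplit : k < m₂ ∨ m₂ = k ∨ (m₂ < k ∧ k ≠ 4 ∧ k ≠ 5) ∨ 4 = k ∨ 5 = k := by omega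
  rcases hsplit with hk | rfl | ⟨hk, hk4, hk5⟩ | rfl | rfl
  · -- an outer face of `h₂`: one flip, at `b`
    rw [odd_xiDeg_iff_not_iff (leftFaceIdx (r₂ + k)) (fun hm' => T.outer₂_not_mem_hBondsW hk (by rw [← side_N_idx]; exact hNW hm')), side_N_idx_add_one,
      side_N_idx_add_two, add_assoc r₂ k 1, P.mem₂ (k + 1) (by omega), P.mem₂ k hk.le, iff_flip]
    constructor
    · intro h; exact Or.inl (by omega)
    · rintro (h | ⟨h, -⟩ | ⟨h, -⟩) <;> omega
  · -- the contact end `Q`: `nb²_{m₂}` is its only new side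
    have ha : side (leftFaceDir h₂ (r₂ + m₂)) (leftFaceIdx (r₂ + m₂) + 1) ∉ N := by
      rw [side_N_idx_add_one, add_assoc r₂ m₂ 1]; unfold nbond
      exact T.mk_not_mem_profile P (triGraph_adj_add_triDir h₂ _) (Or.inr (T.in₂ _ (by omega) (by omega)))
    have hσ : side (leftFaceDir h₂ (r₂ + m₂)) (leftFaceIdx (r₂ + m₂)) ∉ N := by
      rw [side_N_idx, add_assoc r₂ m₂ 1]
      exact T.mk_not_mem_profile P (by
        have := triGraph_adj_add_triDir (h₂ + triDir (r₂ + m₂)) (r₂ + m₂ + 2)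
        rwa [add_triDir_add_triDir_add_two', add_assoc r₂ m₂ 1] at this) (Or.inr (T.in₂ _ (by omega) (by omega)))
    rw [odd_xiDeg_iff_not_iff (leftFaceIdx (r₂ + m₂) + 1) ha, (fin3_facts _).1, (fin3_facts _).2.1, side_N_idx_add_two, P.mem₂ m₂ le_rfl]
    have e2 : ¬ m₂ ≤ k₂ := by omega
    constructor
    · intro h
      refine Or.inr (Or.inl ⟨rfl, fun hxy => h ⟨fun h' => ?_, fun h' => absurd h' hσ⟩⟩)
      exact absurd (h'.1 hxy) e2
    · rintro (h | ⟨-, h⟩ | ⟨h, -⟩)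
      · exfalso; omega
      · exact fun h' => hσ (h'.1 ⟨fun hxy => absurd hxy h, fun h2 => absurd h2 e2⟩)
      · exfalso; omega
  · -- a contact face of `h₂`: all sides in `H_G`
    rw [T.xiDeg_eq_zero_of_sides P (T.sides_N₂_mem_hBonds hk hk4 hk5)]
    refine iff_of_false (by decide) ?_
    rintro (h | ⟨h, -⟩ | ⟨h, -⟩) <;> omega
  · -- the inner junction `c = N²_4 = N¹_{m₁+1}`
    rw [T.c_eq, T.odd_xiDeg_N₁_iff P]
    constructor
    · rintro (h | ⟨h, -⟩ | ⟨-, h⟩)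
      · exfalso; omega
      · exfalso; omega
      · exact Or.inr (Or.inr ⟨rfl, h⟩)
    · rintro (h | ⟨h, -⟩ | ⟨-, h⟩)
      · exfalso; omega
      · exfalso; omega
      · exact Or.inr (Or.inr ⟨rfl, h⟩)
  · -- the outer junction `J = N²_5 = N¹_{m₁}`
    rw [T.J_eq, T.odd_xiDeg_N₁_iff P]
    constructor
    · rintro (h | ⟨h, -⟩ | ⟨h, -⟩) <;> exfalso <;> omega
    · rintro (h | ⟨h, -⟩ | ⟨h, -⟩) <;> exfalso <;> omega

/-- ★ the side count of a profile at an outer face of `h₁` (`k ≤ m₁`): odd iff it is `a`. [cite: KhristoforovSmirnov2021, §1.2 (arXiv v1 pp. 2–3)] -/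
theorem odd_xiDeg_N₁_iff_of_le {k : Fin 6} (hk : k ≤ m₁) : Odd (xiDeg N (leftFaceDir h₁ (r₁ + k))) ↔ k = k₁ := by
  rw [T.odd_xiDeg_N₁_iff P k]
  have hm := T.m₁_le
  constructor
  · rintro (h | ⟨h, -⟩ | ⟨h, -⟩)
    · exact h
    · exfalso; omega
    · exfalso; omega
  · exact Or.inl

/-- ★ the side count of a profile at an outer face of `h₂` (`k < m₂`): odd iff it is `b`. [cite: KhristoforovSmirnov2021, §1.2 (arXiv v1 pp. 2–3)] -/
theorem odd_xiDeg_N₂_iff_of_lt {k : Fin 6} (hk : k < m₂) : Odd (xiDeg N (leftFaceDir h₂ (r₂ + k))) ↔ k = k₂ := by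
  rw [T.odd_xiDeg_N₂_iff P k]
  have hm := T.m₂_le
  constructor
  · rintro (h | ⟨h, -⟩ | ⟨h, -⟩)
    · exact h
    · exfalso; omega
    · exfalso; omega
  · exact Or.inl

/-- ★★ **THE SIDE COUNT OF A PROFILE AT A FACE TOUCHING `G`**: odd iff the face is `P` and `x`, or `c` and `y`, or `Q` and `¬ (x ↔ y)` (the ROOTS of the profile).
[cite: KhristoforovSmirnov2021, §1.2 (arXiv v1 pp. 2–3: loop configurations with prescribed disorders)] -/
theorem odd_xiDeg_iff_of_touching {F : HexVertex} (hF : F ∈ triFacesTouching D.verts) :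
    Odd (xiDeg N F) ↔ (F = leftFaceDir h₁ (r₁ + 5) ∧ x) ∨ (F = leftFaceDir h₁ (r₁ + (m₁ + 1)) ∧ y) ∨ (F = leftFaceDir h₂ (r₂ + m₂) ∧ ¬ (x ↔ y)) := by
  have hm₁ := T.m₁_le
  have hm₂ := T.m₂_le
  have h0₁ := T.k₁_lt
  have h0₂ := T.k₂_lt
  by_cases hF₁ : h₁ ∈ hexFaceVertices F
  · obtain ⟨k, rfl⟩ := exists_eq_N_of_mem r₁ hF₁
    have hk : ¬ k ≤ m₁ := fun hk => T.N₁_not_touching hk hF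
    rw [T.odd_xiDeg_N₁_iff P k]
    have eQ : ¬ (leftFaceDir h₁ (r₁ + k) = leftFaceDir h₂ (r₂ + m₂) ∧ ¬ (x ↔ y)) := fun h => by
      obtain ⟨-, h45 | h45⟩ := T.N₁_eq_N₂_imp h.1 <;> omega
    constructor
    · rintro (h | ⟨rfl, h⟩ | ⟨rfl, h⟩)
      · exfalso; omega
      · exact Or.inl ⟨rfl, h⟩
      · exact Or.inr (Or.inl ⟨rfl, h⟩)
    · rintro (⟨e, h⟩ | ⟨e, h⟩ | h)
      · exact Or.inr (Or.inl ⟨N_inj e, h⟩)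
      · exact Or.inr (Or.inr ⟨N_inj e, h⟩)
      · exact absurd h eQ
  · by_cases hF₂ : h₂ ∈ hexFaceVertices F
    · obtain ⟨k, rfl⟩ := exists_eq_N_of_mem r₂ hF₂
      have hk4 : k ≠ 4 := by rintro rfl; exact hF₁ ((T.h₁_mem_N₂_iff 4).2 (Or.inl rfl))
      have hk5 : k ≠ 5 := by rintro rfl; exact hF₁ ((T.h₁_mem_N₂_iff 5).2 (Or.inr rfl))
      have hk : ¬ k < m₂ := fun hk => T.N₂_not_touching hk hF
      rw [T.odd_xiDeg_N₂_iff P k]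
      have eP : ¬ (leftFaceDir h₂ (r₂ + k) = leftFaceDir h₁ (r₁ + 5) ∧ x) := fun h => hF₁ (by rw [h.1]; exact self_mem_N h₁ _ _)
      have ec : ¬ (leftFaceDir h₂ (r₂ + k) = leftFaceDir h₁ (r₁ + (m₁ + 1)) ∧ y) := fun h => hF₁ (by rw [h.1]; exact self_mem_N h₁ _ _)
      constructor
      · rintro (h | ⟨rfl, h⟩ | ⟨h, -⟩)
        · exfalso; omega
        · exact Or.inr (Or.inr ⟨rfl, h⟩)
        · exact absurd h hk4
      · rintro (h | h | ⟨e, h⟩)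
        · exact absurd h eP
        · exact absurd h ec
        · exact Or.inr (Or.inl ⟨N_inj e, h⟩)
    · rw [xiDeg_eq_zero_of_not_mem P hF₁ hF₂]
      have eP : ¬ (F = leftFaceDir h₁ (r₁ + 5) ∧ x) := fun h => hF₁ (by rw [h.1]; exact self_mem_N h₁ _ _)
      have ec : ¬ (F = leftFaceDir h₁ (r₁ + (m₁ + 1)) ∧ y) := fun h => hF₁ (by rw [h.1]; exact self_mem_N h₁ _ _)
      have eQ : ¬ (F = leftFaceDir h₂ (r₂ + m₂) ∧ ¬ (x ↔ y)) := fun h => hF₂ (by rw [h.1]; exact self_mem_N h₂ _ _)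
      refine iff_of_false (by decide) ?_
      rintro (h | h | h)
      · exact eP h
      · exact ec h
      · exact eQ h

end Parity

end TwoCellData

/-! ## §2 Pendant cases: the small domain with two root marks, and the two-pendant bijection -/

/-- **THE TWO-ROOT-MARKS DATA**: `E` is the small domain `D` (`k` corners) marked additionally at the two ROOT faces `R₁` (at the index `ja` of `a`) and `R₂` (at the index `jb` of `b`);
the old corners keep their faces, relabelled by `skip j`. (The three small domains of the two-cell cap identity: `(R₁, R₂) = (P, Q)`, `(P, c)`, `(c, Q)`.)
[cite: KhristoforovSmirnov2021, §1.2 (arXiv v1 pp. 2–3: disorders on the boundary); PearceRittenbergDeGierNienhuis2002, §2 (the sites `j, j+1`)] -/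
structure TwoCellMarks (D : TriMarkedDomain nm) (E : TriMarkedDomain (nm + 1 + 1)) (ja jb : Fin (nm + 1 + 1)) (j : Fin (nm + 1)) (R₁ R₂ : HexVertex) : Prop where
  /-- same sites -/
  verts : E.verts = D.verts
  /-- the old corner faces, relabelled -/
  yc_skip : ∀ i, yc E (skip j i) = yc D i
  /-- the root of `a`'s pendant sits at `a`'s index -/
  yc_a : yc E ja = R₁
  /-- the root of `b`'s pendant sits at `b`'s index -/
  yc_b : yc E jb = R₂

/-- **A PENDANT CASE OF THE TWO-CELL SURGERY** (bits `(x, y) ≠ (⊥, ⊥)`): a profile `N` with bits `x, y` splitting as two disjoint SINGLE-ROOT PENDANTS — `E₁` through the outer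
faces `S₁ ∋ a`, joining `a` to its root `R₁`, and `E₂` through `S₂ ∋ b`, joining `b` to `R₂` — whose roots are exactly the odd touching faces of the profile, together with the small
domain `E = (Ω; M̂ + R₁ + R₂)`. [cite: KhristoforovSmirnov2021, §1.2 (arXiv v1 p. 2: «IP(ξ) is a union of disjoint paths, matching marked points»); lane tool notion] -/
structure PendantCase (D : TriMarkedDomain nm) (h₁ h₂ : Site 2) (r₁ m₁ k₁ r₂ m₂ k₂ : Fin 6) (ja jb : Fin (nm + 1 + 1)) (j : Fin (nm + 1))
    (E : TriMarkedDomain (nm + 1 + 1)) (x y : Prop) (N E₁ E₂ : Finset (Sym2 (Site 2))) (S₁ S₂ : Finset HexVertex) (R₁ R₂ : HexVertex) : Prop where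
  /-- the marks of the small domain -/
  marks : TwoCellMarks D E ja jb j R₁ R₂
  /-- the roots touch `G` -/
  R₁_touching : R₁ ∈ triFacesTouching D.verts
  /-- the roots touch `G` -/
  R₂_touching : R₂ ∈ triFacesTouching D.verts
  /-- the roots are the odd touching faces of the profile -/
  root_iff : ∀ F ∈ triFacesTouching D.verts, ((F = leftFaceDir h₁ (r₁ + 5) ∧ x) ∨ (F = leftFaceDir h₁ (r₁ + (m₁ + 1)) ∧ y) ∨
    (F = leftFaceDir h₂ (r₂ + m₂) ∧ ¬ (x ↔ y))) ↔ (F = R₁ ∨ F = R₂)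
  /-- `N` is the profile with bits `x, y` -/
  profile : TwoCellProfile h₁ h₂ r₁ m₁ k₁ r₂ m₂ k₂ N x y
  /-- `N` splits as the two pendants -/
  N_eq : N = E₁ ∪ E₂
  /-- the pendant faces do not touch `G` -/
  S_outer : ∀ F ∈ S₁ ∪ S₂, F ∉ triFacesTouching D.verts
  /-- the faces of `E₁` are in `S₁` or the root -/
  faces₁ : ∀ b ∈ E₁, ∀ F : HexVertex, Inc F b → F ∈ S₁ ∨ F = R₁
  /-- the faces of `E₂` are in `S₂` or the root -/
  faces₂ : ∀ b ∈ E₂, ∀ F : HexVertex, Inc F b → F ∈ S₂ ∨ F = R₂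
  /-- the face sets are disjoint -/
  disjS : Disjoint S₁ S₂
  /-- the pendants are disjoint -/
  disj₁₂ : Disjoint E₁ E₂
  /-- `a` is a face of the first pendant -/
  a_mem : leftFaceDir h₁ (r₁ + k₁) ∈ S₁
  /-- `b` is a face of the second pendant -/
  b_mem : leftFaceDir h₂ (r₂ + k₂) ∈ S₂
  /-- the first pendant joins `a` to its root -/
  conn₁ : (sideGraph E₁).Reachable (leftFaceDir h₁ (r₁ + k₁)) R₁
  /-- the second pendant joins `b` to its root -/
  conn₂ : (sideGraph E₂).Reachable (leftFaceDir h₂ (r₂ + k₂)) R₂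

namespace TwoCellData

variable {W : TriMarkedDomain (nm + 1 + 1)} {D : TriMarkedDomain nm} {h₁ h₂ : Site 2} {r₁ m₁ k₁ r₂ m₂ k₂ : Fin 6} {ja jb : Fin (nm + 1 + 1)} {j : Fin (nm + 1)}
  (T : TwoCellData W D h₁ h₂ r₁ m₁ k₁ r₂ m₂ k₂ ja jb j)
include T

/-! ### The marks of the small domain -/

section Marks

variable {E : TriMarkedDomain (nm + 1 + 1)} {R₁ R₂ : HexVertex} (M : TwoCellMarks D E ja jb j R₁ R₂)
include M

omit T in
/-- same `H`-bonds (private copy of #937's `MarksData.hBonds_eq` for the two-root marks data). [cite: KhristoforovSmirnov2021, §1.2 (arXiv v1 p. 2)] -/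
private theorem hBondsE_eq : hBonds E = hBonds D := hBonds_eq_of_verts_eq' (D := D) M.verts

/-- ★ **the corner faces of `E`**: those of `D`, or `R₁`, or `R₂`. [cite: KhristoforovSmirnov2021, §1.2 (arXiv v1 pp. 2–3)] -/
theorem mem_cornersE_iff {F : HexVertex} : F ∈ corners E ↔ F ∈ corners D ∨ F = R₁ ∨ F = R₂ := by
  rw [mem_corners, mem_corners]
  constructor
  · rintro ⟨x, rfl⟩
    rcases T.eq_ja_or_jb_or_skip x with rfl | rfl | ⟨i, rfl⟩
    · exact Or.inr (Or.inl M.yc_a)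
    · exact Or.inr (Or.inr M.yc_b)
    · exact Or.inl ⟨i, M.yc_skip i⟩
  · rintro (⟨i, rfl⟩ | rfl | rfl)
    · exact ⟨skip j i, (M.yc_skip i).symm⟩
    · exact ⟨ja, M.yc_a.symm⟩
    · exact ⟨jb, M.yc_b.symm⟩

/-- the roots are not corner faces of `D`. [cite: KhristoforovSmirnov2021, §1.2 (arXiv v1 pp. 2–3)] -/
theorem root_not_corner {F : HexVertex} (hF : F = R₁ ∨ F = R₂) : F ∉ corners D := by
  rw [mem_corners]
  rintro ⟨i, rfl⟩
  rw [← M.yc_skip i] at hF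
  rcases hF with e | e
  · exact T.skip_ne_ja i (yc_injective E (e.trans M.yc_a.symm))
  · exact T.skip_ne_jb i (yc_injective E (e.trans M.yc_b.symm))

/-- `R₁ ≠ R₂`. [cite: KhristoforovSmirnov2021, §1.2 (arXiv v1 pp. 2–3)] -/
theorem R₁_ne_R₂ : R₁ ≠ R₂ := by
  rw [← M.yc_a, ← M.yc_b]
  exact fun e => T.ja_ne_jb (yc_injective E e)

end Marks

/-! ### The two-pendant bijection of a pendant case -/

section Pendant

variable {E : TriMarkedDomain (nm + 1 + 1)} {x y : Prop} {N E₁ E₂ : Finset (Sym2 (Site 2))} {S₁ S₂ : Finset HexVertex} {R₁ R₂ : HexVertex}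
  (C : PendantCase D h₁ h₂ r₁ m₁ k₁ r₂ m₂ k₂ ja jb j E x y N E₁ E₂ S₁ S₂ R₁ R₂)
include C

omit T in
/-- a face touching `G` is not a pendant face. [cite: BollobasRiordan2006, Ch. 7 §7.2.2 p. 168] -/
theorem not_mem_S_of_touching {F : HexVertex} (hF : F ∈ triFacesTouching D.verts) : F ∉ S₁ ∪ S₂ := fun h => C.S_outer F h hF

/-- ★ **the two pendants of a pendant case over any `ξ ⊆ H_G`.** [cite: KhristoforovSmirnov2021, §1.2 (arXiv v1 p. 2: «IP(ξ) is a union of disjoint paths»)] -/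
theorem twoPendants {ξ : Finset (Sym2 (Site 2))} (hξ : ξ ⊆ hBonds D) : TwoPendants ξ E₁ E₂ S₁ S₂ R₁ R₂ where
  sides₁ := fun F hF l hl => by
    rcases Finset.mem_union.1 hl with h | h
    · exact absurd (mem_touching_of_side_mem D (hξ h)) (C.S_outer F (Finset.mem_union_left _ hF))
    · rcases Finset.mem_union.1 h with h | h
      · exact h
      · exfalso
        rcases C.faces₂ _ h F (inc_side F l) with h' | h'
        · exact Finset.disjoint_left.1 C.disjS hF h'
        · exact C.S_outer F (Finset.mem_union_left _ hF) (h' ▸ C.R₂_touching)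
  sides₂ := fun F hF l hl => by
    rcases Finset.mem_union.1 hl with h | h
    · exact absurd (mem_touching_of_side_mem D (hξ h)) (C.S_outer F (Finset.mem_union_right _ hF))
    · rcases Finset.mem_union.1 h with h | h
      · exfalso
        rcases C.faces₁ _ h F (inc_side F l) with h' | h'
        · exact Finset.disjoint_left.1 C.disjS h' hF
        · exact C.S_outer F (Finset.mem_union_right _ hF) (h' ▸ C.R₁_touching)
      · exact h
  root₁ := fun F hF hR l hl => by
    rcases C.faces₁ _ hl F (inc_side F l) with h | h
    · exact hF h
    · exact hR h
  root₂ := fun F hF hR l hl => by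
    rcases C.faces₂ _ hl F (inc_side F l) with h | h
    · exact hF h
    · exact hR h
  disj₁ := Finset.disjoint_left.2 fun _ hb hb1 => T.not_mem_profile_of_mem_hBonds C.profile (hξ hb) (by rw [C.N_eq]; exact Finset.mem_union_left _ hb1)
  disj₂ := Finset.disjoint_left.2 fun _ hb hb2 => T.not_mem_profile_of_mem_hBonds C.profile (hξ hb) (by rw [C.N_eq]; exact Finset.mem_union_right _ hb2)
  disj₁₂ := C.disj₁₂
  disjS := C.disjS
  R₁_notMem := fun h => C.S_outer _ h C.R₁_touching
  R₂_notMem := fun h => C.S_outer _ h C.R₂_touching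

/-- ★ **links among faces touching `G` are unchanged** by adding the two pendants. [cite: KhristoforovSmirnov2021, §1.2 (arXiv v1 p. 2: «IP(ξ) is a union of disjoint paths»)] -/
theorem reachable_union_iff {ξ : Finset (Sym2 (Site 2))} (hξ : ξ ⊆ hBonds D) {X Y : HexVertex} (hX : X ∈ triFacesTouching D.verts)
    (hY : Y ∈ triFacesTouching D.verts) : (sideGraph (ξ ∪ N)).Reachable X Y ↔ (sideGraph ξ).Reachable X Y := by
  rw [C.N_eq]
  exact (T.twoPendants C hξ).reachable_union_two_pendants (not_mem_S_of_touching C hX) (not_mem_S_of_touching C hY)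

/-- ★ **`a` is linked to what `R₁` was linked to.** [cite: KhristoforovSmirnov2021, §1.2 (arXiv v1 p. 2: «IP(ξ) is a union of disjoint paths»)] -/
theorem reachable_a_union_iff {ξ : Finset (Sym2 (Site 2))} (hξ : ξ ⊆ hBonds D) {Y : HexVertex} (hY : Y ∈ triFacesTouching D.verts) :
    (sideGraph (ξ ∪ N)).Reachable (leftFaceDir h₁ (r₁ + k₁)) Y ↔ (sideGraph ξ).Reachable R₁ Y := by
  rw [C.N_eq]
  exact (T.twoPendants C hξ).reachable_union_two_pendants_root₁ C.a_mem C.conn₁ (not_mem_S_of_touching C hY)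

/-- ★ **`b` is linked to what `R₂` was linked to.** [cite: KhristoforovSmirnov2021, §1.2 (arXiv v1 p. 2: «IP(ξ) is a union of disjoint paths»)] -/
theorem reachable_b_union_iff {ξ : Finset (Sym2 (Site 2))} (hξ : ξ ⊆ hBonds D) {Y : HexVertex} (hY : Y ∈ triFacesTouching D.verts) :
    (sideGraph (ξ ∪ N)).Reachable (leftFaceDir h₂ (r₂ + k₂)) Y ↔ (sideGraph ξ).Reachable R₂ Y := by
  rw [C.N_eq]
  exact (T.twoPendants C hξ).reachable_union_two_pendants_root₂ C.b_mem C.conn₂ (not_mem_S_of_touching C hY)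

/-- ★ **`a` is linked to `b` iff `R₁` was linked to `R₂`.** [cite: KhristoforovSmirnov2021, §1.2 (arXiv v1 p. 2: «IP(ξ) is a union of disjoint paths»)] -/
theorem reachable_a_b_union_iff {ξ : Finset (Sym2 (Site 2))} (hξ : ξ ⊆ hBonds D) :
    (sideGraph (ξ ∪ N)).Reachable (leftFaceDir h₁ (r₁ + k₁)) (leftFaceDir h₂ (r₂ + k₂)) ↔ (sideGraph ξ).Reachable R₁ R₂ := by
  rw [C.N_eq]
  exact (T.twoPendants C hξ).reachable_union_two_pendants_roots C.a_mem C.conn₁ C.b_mem C.conn₂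

/-- the side count of the profile at a face touching `G` is odd iff the face is a root. [cite: KhristoforovSmirnov2021, §1.2 (arXiv v1 p. 2)] -/
theorem odd_xiDeg_N_iff_of_touching {F : HexVertex} (hF : F ∈ triFacesTouching D.verts) : Odd (xiDeg N F) ↔ F = R₁ ∨ F = R₂ :=
  (T.odd_xiDeg_iff_of_touching C.profile hF).trans (C.root_iff F hF)

omit T C in
/-- propositional bookkeeping of the parity profile at a face touching `G`. [cite: KhristoforovSmirnov2021, §1.2 (arXiv v1 pp. 2–3); lane plumbing] -/
private theorem prop_parity' (O R C X : Prop) (hCR : C → ¬ R) : ((O ↔ ¬ R) ↔ (C ∧ ¬ X ∨ X ∧ ¬ C)) ↔ (O ↔ ((C ∨ R) ∧ ¬ X ∨ X ∧ ¬ (C ∨ R))) := by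
  tauto

/-- ★★ **THE PARITY PROFILES CORRESPOND**: for `ξ ⊆ H_G` and a face `s` touching `G`, `ξ ∪ N` has odd faces «corners of `W` XOR `s`» over the faces touching `G'` iff `ξ` has odd
faces «corners of `E` XOR `s`» over the faces touching `G` (the pendants flip the parity exactly at their roots, the two extra corners of `E`, and realise the corners `a`, `b`).
[cite: KhristoforovSmirnov2021, §1.2 (arXiv v1 pp. 2–3: loop configurations with prescribed disorders)] -/
theorem parityIs_union_iff {ξ : Finset (Sym2 (Site 2))} (hξ : ξ ⊆ hBonds D) {s : HexVertex} (hs : s ∈ triFacesTouching D.verts) :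
    ParityIs W (ξ ∪ N) (symmDiff (corners W) {s}) ↔ ParityIs E ξ (symmDiff (corners E) {s}) := by
  have hdisj := T.disjoint_profile C.profile hξ
  have key : ∀ F ∈ triFacesTouching D.verts,
      ((Odd (xiDeg (ξ ∪ N) F) ↔ F ∈ symmDiff (corners W) {s}) ↔ (Odd (xiDeg ξ F) ↔ F ∈ symmDiff (corners E) {s})) := by
    intro F hF
    rw [xiDeg_union_of_disjoint hdisj, Nat.odd_add, ← Nat.not_odd_iff_even, T.odd_xiDeg_N_iff_of_touching C hF, Finset.mem_symmDiff, Finset.mem_symmDiff,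
      Finset.mem_singleton, T.mem_cornersW_iff_of_touching hF, T.mem_cornersE_iff C.marks]
    exact prop_parity' _ _ _ _ fun hC hR => T.root_not_corner C.marks hR hC
  unfold ParityIs
  rw [C.marks.verts]
  constructor
  · intro hP F hF
    exact (key F hF).1 (hP F (T.mem_touchingW_iff.2 (Or.inl hF)))
  · intro hP F hF
    rcases T.mem_touchingW_iff.1 hF with hF₁ | ⟨k, hk, rfl⟩ | ⟨k, hk, rfl⟩
    · exact (key F hF₁).2 (hP F hF₁)
    · -- an outer face of `h₁`: no `ξ`-side, odd for the profile iff it is `a`, a corner of `W` iff it is `a`, not `s`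
      have h0 : xiDeg ξ (leftFaceDir h₁ (r₁ + k)) = 0 := by
        rw [l1_xiDeg_eq, Finset.card_eq_zero, Finset.filter_eq_empty_iff]
        intro l _ hl
        exact T.N₁_not_touching hk (mem_touching_of_side_mem D (hξ hl))
      rw [xiDeg_union_of_disjoint hdisj, h0, zero_add, T.odd_xiDeg_N₁_iff_of_le C.profile hk, Finset.mem_symmDiff, Finset.mem_singleton, T.N₁_mem_cornersW_iff hk]
      have hks : leftFaceDir h₁ (r₁ + k) ≠ s := fun e => T.N₁_not_touching hk (e ▸ hs)
      simp only [hks, not_false_iff, and_true, false_and, or_false]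
    · -- an outer face of `h₂`
      have h0 : xiDeg ξ (leftFaceDir h₂ (r₂ + k)) = 0 := by
        rw [l1_xiDeg_eq, Finset.card_eq_zero, Finset.filter_eq_empty_iff]
        intro l _ hl
        exact T.N₂_not_touching hk (mem_touching_of_side_mem D (hξ hl))
      rw [xiDeg_union_of_disjoint hdisj, h0, zero_add, T.odd_xiDeg_N₂_iff_of_lt C.profile hk, Finset.mem_symmDiff, Finset.mem_singleton, T.N₂_mem_cornersW_iff hk]
      have hks : leftFaceDir h₂ (r₂ + k) ≠ s := fun e => T.N₂_not_touching hk (e ▸ hs)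
      simp only [hks, not_false_iff, and_true, false_and, or_false]

/-- ★★ **ADDING THE TWO PENDANTS IS A BIJECTION ONTO THE CONFIGURATIONS OF `W` WITH THAT PROFILE**: for `ξ ⊆ H_G`, `ξ ∪ N ∈ W^{W}_z(s)` iff `ξ ∈ W^{E}_z(s)` (`z = side v i` an
`H_G`-edge, `s` touching `G`). [cite: KhristoforovSmirnov2021, §1.2 (arXiv v1 pp. 2–3); §2 Definition 3 (p. 4)] -/
theorem union_mem_TXb_iff {ξ : Finset (Sym2 (Site 2))} (hξ : ξ ⊆ hBonds D) {v : HexVertex} {i : Fin 3} (hz : side v i ∈ hBonds D) {s : HexVertex}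
    (hs : s ∈ triFacesTouching D.verts) : ξ ∪ N ∈ TXb W v i s ↔ ξ ∈ TXb E v i s := by
  rw [mem_TXb_iff, mem_TXb_iff, T.parityIs_union_iff C hξ hs, hBondsE_eq C.marks]
  refine and_congr ⟨fun h1 b hb => ?_, fun h1 b hb => ?_⟩ Iff.rfl
  · exact Finset.mem_erase.2 ⟨(Finset.mem_erase.1 (h1 (Finset.mem_union_left _ hb))).1, hξ hb⟩
  · rcases Finset.mem_union.1 hb with hb | hb
    · exact Finset.mem_erase.2 ⟨(Finset.mem_erase.1 (h1 hb)).1, T.hBonds_subset (hξ hb)⟩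
    · refine Finset.mem_erase.2 ⟨?_, T.profile_subset_hBondsW C.profile hb⟩
      rintro rfl
      exact T.not_mem_profile_of_mem_hBonds C.profile hz hb

/-- ★ **the partner corresponds** (`a ↦ R₁`, `b ↦ R₂` is the identity on corner indices). [cite: KhristoforovSmirnov2021, §2 Definition 3 (arXiv v1 p. 4: the event `z ↔ u_j`)] -/
theorem inClassX_union_iff {ξ : Finset (Sym2 (Site 2))} (hξ : ξ ⊆ hBonds D) {v : HexVertex} {i : Fin 3} (hz : side v i ∈ hBonds D) {s : HexVertex}
    (hs : s ∈ triFacesTouching D.verts) (p : Fin (nm + 1 + 1)) :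
    InClassX W (faceVertex v (i + 1)) (faceVertex v (i + 2)) s p (ξ ∪ N) ↔ InClassX E (faceVertex v (i + 1)) (faceVertex v (i + 2)) s p ξ := by
  rw [hbK_inClassX_iff, hbK_inClassX_iff]
  refine and_congr (T.union_mem_TXb_iff C hξ hz hs) ?_
  rcases T.eq_ja_or_jb_or_skip p with rfl | rfl | ⟨c, rfl⟩
  · rw [T.yc_a, C.marks.yc_a, SimpleGraph.reachable_comm, T.reachable_a_union_iff C hξ hs, SimpleGraph.reachable_comm]
  · rw [T.yc_b, C.marks.yc_b, SimpleGraph.reachable_comm, T.reachable_b_union_iff C hξ hs, SimpleGraph.reachable_comm]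
  · rw [T.yc_skip, C.marks.yc_skip]
    exact T.reachable_union_iff C hξ hs (yc_mem_touching D c)

/-- ★ **the link relation corresponds.** [cite: KhristoforovSmirnov2021, §1.2 (arXiv v1 p. 2: the link pattern `IP(ξ)`)] -/
theorem linkRel_union_eq {ξ : Finset (Sym2 (Site 2))} (hξ : ξ ⊆ hBonds D) : linkRel W (ξ ∪ N) = linkRel E ξ := by
  ext ⟨u, w⟩
  rw [mem_linkRel, mem_linkRel, xiLinked_iff_reachable, xiLinked_iff_reachable]
  refine and_congr Iff.rfl ?_
  rcases T.eq_ja_or_jb_or_skip u with rfl | rfl | ⟨a', rfl⟩ <;> rcases T.eq_ja_or_jb_or_skip w with e | e | ⟨b', e⟩ <;> (try subst e)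
  · exact ⟨fun _ => SimpleGraph.Reachable.refl _, fun _ => SimpleGraph.Reachable.refl _⟩
  · rw [T.yc_a, T.yc_b, C.marks.yc_a, C.marks.yc_b]
    exact T.reachable_a_b_union_iff C hξ
  · rw [T.yc_a, T.yc_skip, C.marks.yc_a, C.marks.yc_skip]
    exact T.reachable_a_union_iff C hξ (yc_mem_touching D b')
  · rw [T.yc_a, T.yc_b, C.marks.yc_a, C.marks.yc_b, SimpleGraph.reachable_comm, T.reachable_a_b_union_iff C hξ, SimpleGraph.reachable_comm]
  · exact ⟨fun _ => SimpleGraph.Reachable.refl _, fun _ => SimpleGraph.Reachable.refl _⟩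
  · rw [T.yc_b, T.yc_skip, C.marks.yc_b, C.marks.yc_skip]
    exact T.reachable_b_union_iff C hξ (yc_mem_touching D b')
  · rw [T.yc_a, T.yc_skip, C.marks.yc_a, C.marks.yc_skip, SimpleGraph.reachable_comm, T.reachable_a_union_iff C hξ (yc_mem_touching D a'),
      SimpleGraph.reachable_comm]
  · rw [T.yc_b, T.yc_skip, C.marks.yc_b, C.marks.yc_skip, SimpleGraph.reachable_comm, T.reachable_b_union_iff C hξ (yc_mem_touching D a'),
      SimpleGraph.reachable_comm]
  · rw [T.yc_skip, T.yc_skip, C.marks.yc_skip, C.marks.yc_skip]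
    exact T.reachable_union_iff C hξ (yc_mem_touching D a') (yc_mem_touching D b')

/-- **restriction**: a configuration of `W` with the bits `x`, `y` is `ξ ∪ N` with `ξ` its `H_G`-part. [cite: KhristoforovSmirnov2021, §1.2 (arXiv v1 p. 2)] -/
theorem eq_filter_union {v : HexVertex} {i : Fin 3} {s : HexVertex} (hs : s ∈ triFacesTouching D.verts) {ζ : Finset (Sym2 (Site 2))} (hζ : ζ ∈ TXb W v i s)
    (hx : nbond h₁ r₁ ∈ ζ ↔ x) (hy : nbond h₁ (r₁ + (m₁ + 1)) ∈ ζ ↔ y) :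
    ζ = ζ.filter (fun b => b ∈ hBonds D) ∪ N ∧ ζ.filter (fun b => b ∈ hBonds D) ⊆ hBonds D := by
  have e : ζ.filter (fun b => b ∉ hBonds D) = N := (T.isProfile_filter hs hζ).eq_of_iff C.profile T.m₁_le hx hy
  rw [← e]
  exact ⟨eq_filter_union_filter ζ, fun b hb => (Finset.mem_filter.1 hb).2⟩

/-- the `H_G`-part of `ξ ∪ N` is `ξ`. [cite: KhristoforovSmirnov2021, §1.2 (arXiv v1 p. 2)] -/
theorem filter_union_eq {ξ : Finset (Sym2 (Site 2))} (hξ : ξ ⊆ hBonds D) : (ξ ∪ N).filter (fun b => b ∈ hBonds D) = ξ := by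
  classical
  ext b
  rw [Finset.mem_filter, Finset.mem_union]
  constructor
  · rintro ⟨hb | hb, hb₁⟩
    · exact hb
    · exact absurd hb (T.not_mem_profile_of_mem_hBonds C.profile hb₁)
  · exact fun hb => ⟨Or.inl hb, hξ hb⟩

/-- `nb¹_0 ∈ ξ ∪ N ↔ x` and `I ∈ ξ ∪ N ↔ y` for `ξ ⊆ H_G`. [cite: KhristoforovSmirnov2021, §1.2 (arXiv v1 p. 2)] -/
theorem bits_union {ξ : Finset (Sym2 (Site 2))} (hξ : ξ ⊆ hBonds D) : (nbond h₁ r₁ ∈ ξ ∪ N ↔ x) ∧ (nbond h₁ (r₁ + (m₁ + 1)) ∈ ξ ∪ N ↔ y) := by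
  have h0 := C.profile.mem₁ 0 (Fin.zero_le _)
  have h0' := T.new₁_not_mem_hBonds (k := 0) (by have := T.m₁_le; omega)
  rw [add_zero] at h0 h0'
  rw [Finset.mem_union, Finset.mem_union, h0, C.profile.memI]
  constructor
  · constructor
    · rintro (h | h)
      · exact absurd (hξ h) h0'
      · exact h.2 (Fin.zero_le _)
    · exact fun h => Or.inr ⟨fun _ => Fin.zero_le _, fun _ => h⟩
  · constructor
    · rintro (h | h)
      · exact absurd (hξ h) T.I_not_mem_hBonds
      · exact h
    · exact fun h => Or.inr h

open Classical in
/-- ★★★ **THE CLASS COUNTS CORRESPOND**: the configurations of `W` at `z` (odd face `s`) with bits `x, y`, partner `u_p` and link relation `L` are equinumerous — by deleting the two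
pendants — with the configurations of `E` at `z` with partner `u_p` and link relation `L`. [cite: KhristoforovSmirnov2021, §1.2 (arXiv v1 p. 2) and §2 Definition 3 (p. 4)] -/
theorem card_filter_case_eq {v : HexVertex} {i : Fin 3} (hz : side v i ∈ hBonds D) {s : HexVertex} (hs : s ∈ triFacesTouching D.verts) (p : Fin (nm + 1 + 1))
    (L : Finset (Fin (nm + 1 + 1) × Fin (nm + 1 + 1))) :
    #((TXb W v i s).filter fun ζ => (InClassX W (faceVertex v (i + 1)) (faceVertex v (i + 2)) s p ζ ∧ linkRel W ζ = L) ∧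
        ((nbond h₁ r₁ ∈ ζ ↔ x) ∧ (nbond h₁ (r₁ + (m₁ + 1)) ∈ ζ ↔ y))) =
      #((TXb E v i s).filter fun ξ => InClassX E (faceVertex v (i + 1)) (faceVertex v (i + 2)) s p ξ ∧ linkRel E ξ = L) := by
  refine Finset.card_bij (fun ζ _ => ζ.filter (fun b => b ∈ hBonds D)) (fun ζ hζ => ?_) (fun ζ₁ h₁ ζ₂ h₂ e => ?_) (fun ξ hξ => ?_)
  · rw [Finset.mem_filter] at hζ ⊢
    obtain ⟨hmem, ⟨hcl, hL⟩, hx, hy⟩ := hζ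
    obtain ⟨e, hξ⟩ := T.eq_filter_union C hs hmem hx hy
    rw [e] at hmem hcl hL
    exact ⟨(T.union_mem_TXb_iff C hξ hz hs).1 hmem, (T.inClassX_union_iff C hξ hz hs p).1 hcl, (T.linkRel_union_eq C hξ) ▸ hL⟩
  · rw [Finset.mem_filter] at h₁ h₂
    rw [(T.eq_filter_union C hs h₁.1 h₁.2.2.1 h₁.2.2.2).1, (T.eq_filter_union C hs h₂.1 h₂.2.2.1 h₂.2.2.2).1, e]
  · rw [Finset.mem_filter] at hξ
    obtain ⟨hmem, hcl, hL⟩ := hξ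
    have hξD : ξ ⊆ hBonds D := by
      intro b hb
      have := ((mem_TXb_iff (D := E) v i s ξ).1 hmem).1 hb
      rw [hBondsE_eq C.marks] at this
      exact (Finset.mem_erase.1 this).2
    refine ⟨ξ ∪ N, ?_, T.filter_union_eq C hξD⟩
    rw [Finset.mem_filter]
    exact ⟨(T.union_mem_TXb_iff C hξD hz hs).2 hmem, ⟨(T.inClassX_union_iff C hξD hz hs p).2 hcl, by rw [T.linkRel_union_eq C hξD]; exact hL⟩,
      T.bits_union C hξD⟩

end Pendant

/-! ## §3 The cap case: one rootless path joining `a` to `b`, and the cap insertion of the pattern -/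

end TwoCellData

/-- **THE CAP CASE OF THE TWO-CELL SURGERY** (bits `⊥, ⊥`): the profile `N` with both bits false is ONE ROOTLESS path through outer faces `S` joining `a` to `b` (no face off `S` has a
side in `N`). [cite: KhristoforovSmirnov2021, §1.2 (arXiv v1 p. 2: «IP(ξ) is a union of disjoint paths»); PearceRittenbergDeGierNienhuis2002, §2 (the cap joins `j` to `j+1`); lane tool notion] -/
structure CapCase (D : TriMarkedDomain nm) (h₁ h₂ : Site 2) (r₁ m₁ k₁ r₂ m₂ k₂ : Fin 6) (N : Finset (Sym2 (Site 2))) (S : Finset HexVertex) : Prop where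
  /-- `N` is the profile with both bits false -/
  profile : TwoCellProfile h₁ h₂ r₁ m₁ k₁ r₂ m₂ k₂ N False False
  /-- the path faces do not touch `G` -/
  S_outer : ∀ F ∈ S, F ∉ triFacesTouching D.verts
  /-- every face of the path is in `S` (no root) -/
  faces : ∀ b ∈ N, ∀ F : HexVertex, Inc F b → F ∈ S
  /-- `a` is on the path -/
  a_mem : leftFaceDir h₁ (r₁ + k₁) ∈ S
  /-- `b` is on the path -/
  b_mem : leftFaceDir h₂ (r₂ + k₂) ∈ S
  /-- the path joins `a` to `b` -/
  conn : (sideGraph N).Reachable (leftFaceDir h₁ (r₁ + k₁)) (leftFaceDir h₂ (r₂ + k₂))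

namespace TwoCellData

variable {W : TriMarkedDomain (nm + 1 + 1)} {D : TriMarkedDomain nm} {h₁ h₂ : Site 2} {r₁ m₁ k₁ r₂ m₂ k₂ : Fin 6} {ja jb : Fin (nm + 1 + 1)} {j : Fin (nm + 1)}
  (T : TwoCellData W D h₁ h₂ r₁ m₁ k₁ r₂ m₂ k₂ ja jb j)
include T

section Cap

variable {N : Finset (Sym2 (Site 2))} {S : Finset HexVertex} (C : CapCase D h₁ h₂ r₁ m₁ k₁ r₂ m₂ k₂ N S)
include C

/-- the rootless-pendant hypotheses for `N` over `ξ ⊆ H_G`. [cite: KhristoforovSmirnov2021, §1.2 (arXiv v1 p. 2)] -/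
theorem rootless {ξ : Finset (Sym2 (Site 2))} (hξ : ξ ⊆ hBonds D) :
    (∀ F ∈ S, ∀ l : Fin 3, side F l ∈ ξ ∪ N → side F l ∈ N) ∧ (∀ F, F ∉ S → ∀ l : Fin 3, side F l ∉ N) ∧ Disjoint ξ N := by
  refine ⟨fun F hF l hl => ?_, fun F hF l hl => hF (C.faces _ hl F (inc_side F l)), T.disjoint_profile C.profile hξ⟩
  rcases Finset.mem_union.1 hl with h | h
  · exact absurd (mem_touching_of_side_mem D (hξ h)) (C.S_outer F hF)
  · exact h

/-- ★ **the cap changes no link among faces touching `G`.** [cite: KhristoforovSmirnov2021, §1.2 (arXiv v1 p. 2: «IP(ξ) is a union of disjoint paths»)] -/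
theorem reachable_union_iff₀ {ξ : Finset (Sym2 (Site 2))} (hξ : ξ ⊆ hBonds D) {X Y : HexVertex} (hX : X ∈ triFacesTouching D.verts)
    (hY : Y ∈ triFacesTouching D.verts) : (sideGraph (ξ ∪ N)).Reachable X Y ↔ (sideGraph ξ).Reachable X Y :=
  reachable_union_rootless (T.rootless C hξ).1 (T.rootless C hξ).2.1 (T.rootless C hξ).2.2 (fun h => C.S_outer X h hX) (fun h => C.S_outer Y h hY)

/-- ★ **`a` is linked to no face touching `G`.** [cite: KhristoforovSmirnov2021, §1.2 (arXiv v1 p. 2: «IP(ξ) is a union of disjoint paths»)] -/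
theorem not_reachable_a_union₀ {ξ : Finset (Sym2 (Site 2))} (hξ : ξ ⊆ hBonds D) {Y : HexVertex} (hY : Y ∈ triFacesTouching D.verts) :
    ¬ (sideGraph (ξ ∪ N)).Reachable (leftFaceDir h₁ (r₁ + k₁)) Y :=
  not_reachable_union_rootless (T.rootless C hξ).1 (T.rootless C hξ).2.1 (T.rootless C hξ).2.2 C.a_mem (fun h => C.S_outer Y h hY)

/-- ★ **`b` is linked to no face touching `G`.** [cite: KhristoforovSmirnov2021, §1.2 (arXiv v1 p. 2: «IP(ξ) is a union of disjoint paths»)] -/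
theorem not_reachable_b_union₀ {ξ : Finset (Sym2 (Site 2))} (hξ : ξ ⊆ hBonds D) {Y : HexVertex} (hY : Y ∈ triFacesTouching D.verts) :
    ¬ (sideGraph (ξ ∪ N)).Reachable (leftFaceDir h₂ (r₂ + k₂)) Y :=
  not_reachable_union_rootless (T.rootless C hξ).1 (T.rootless C hξ).2.1 (T.rootless C hξ).2.2 C.b_mem (fun h => C.S_outer Y h hY)

/-- ★ **`a` is linked to `b`.** [cite: KhristoforovSmirnov2021, §1.2 (arXiv v1 p. 2); PearceRittenbergDeGierNienhuis2002, §2 (the cap joins `j` to `j+1`)] -/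
theorem reachable_a_b_union₀ {ξ : Finset (Sym2 (Site 2))} (hξ : ξ ⊆ hBonds D) :
    (sideGraph (ξ ∪ N)).Reachable (leftFaceDir h₁ (r₁ + k₁)) (leftFaceDir h₂ (r₂ + k₂)) :=
  (reachable_union_rootless_inner (T.rootless C hξ).1 (T.rootless C hξ).2.1 C.a_mem).2 C.conn

/-- the side count of the cap profile at a face touching `G` is even. [cite: KhristoforovSmirnov2021, §1.2 (arXiv v1 p. 2)] -/
theorem not_odd_xiDeg_of_touching₀ {F : HexVertex} (hF : F ∈ triFacesTouching D.verts) : ¬ Odd (xiDeg N F) := by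
  rw [T.odd_xiDeg_iff_of_touching C.profile hF]
  rintro (⟨-, h⟩ | ⟨-, h⟩ | ⟨-, h⟩)
  · exact h
  · exact h
  · exact h Iff.rfl

omit T C in
/-- propositional bookkeeping of the parity profile at a face touching `G` (cap case). [cite: KhristoforovSmirnov2021, §1.2 (arXiv v1 pp. 2–3); lane plumbing] -/
private theorem prop_parity₀ (O R A : Prop) (hR : ¬ R) : ((O ↔ ¬ R) ↔ A) ↔ (O ↔ A) := by
  tauto

/-- ★★ **THE PARITY PROFILES CORRESPOND (cap case)**: for `ξ ⊆ H_G` and `s` touching `G`, `ξ ∪ N` has odd faces «corners of `W` XOR `s`» over the faces touching `G'` iff `ξ` has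
odd faces «corners of `D` XOR `s`» over the faces touching `G`. [cite: KhristoforovSmirnov2021, §1.2 (arXiv v1 pp. 2–3: loop configurations with prescribed disorders)] -/
theorem parityIs_union_iff₀ {ξ : Finset (Sym2 (Site 2))} (hξ : ξ ⊆ hBonds D) {s : HexVertex} (hs : s ∈ triFacesTouching D.verts) :
    ParityIs W (ξ ∪ N) (symmDiff (corners W) {s}) ↔ ParityIs D ξ (symmDiff (corners D) {s}) := by
  have hdisj := T.disjoint_profile C.profile hξ
  have key : ∀ F ∈ triFacesTouching D.verts,
      ((Odd (xiDeg (ξ ∪ N) F) ↔ F ∈ symmDiff (corners W) {s}) ↔ (Odd (xiDeg ξ F) ↔ F ∈ symmDiff (corners D) {s})) := by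
    intro F hF
    rw [xiDeg_union_of_disjoint hdisj, Nat.odd_add, ← Nat.not_odd_iff_even, Finset.mem_symmDiff, Finset.mem_symmDiff, Finset.mem_singleton,
      T.mem_cornersW_iff_of_touching hF]
    exact prop_parity₀ _ _ _ (T.not_odd_xiDeg_of_touching₀ C hF)
  unfold ParityIs
  constructor
  · intro hP F hF
    exact (key F hF).1 (hP F (T.mem_touchingW_iff.2 (Or.inl hF)))
  · intro hP F hF
    rcases T.mem_touchingW_iff.1 hF with hF₁ | ⟨k, hk, rfl⟩ | ⟨k, hk, rfl⟩
    · exact (key F hF₁).2 (hP F hF₁)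
    · have h0 : xiDeg ξ (leftFaceDir h₁ (r₁ + k)) = 0 := by
        rw [l1_xiDeg_eq, Finset.card_eq_zero, Finset.filter_eq_empty_iff]
        intro l _ hl
        exact T.N₁_not_touching hk (mem_touching_of_side_mem D (hξ hl))
      rw [xiDeg_union_of_disjoint hdisj, h0, zero_add, T.odd_xiDeg_N₁_iff_of_le C.profile hk, Finset.mem_symmDiff, Finset.mem_singleton, T.N₁_mem_cornersW_iff hk]
      have hks : leftFaceDir h₁ (r₁ + k) ≠ s := fun e => T.N₁_not_touching hk (e ▸ hs)
      simp only [hks, not_false_iff, and_true, false_and, or_false]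
    · have h0 : xiDeg ξ (leftFaceDir h₂ (r₂ + k)) = 0 := by
        rw [l1_xiDeg_eq, Finset.card_eq_zero, Finset.filter_eq_empty_iff]
        intro l _ hl
        exact T.N₂_not_touching hk (mem_touching_of_side_mem D (hξ hl))
      rw [xiDeg_union_of_disjoint hdisj, h0, zero_add, T.odd_xiDeg_N₂_iff_of_lt C.profile hk, Finset.mem_symmDiff, Finset.mem_singleton, T.N₂_mem_cornersW_iff hk]
      have hks : leftFaceDir h₂ (r₂ + k) ≠ s := fun e => T.N₂_not_touching hk (e ▸ hs)
      simp only [hks, not_false_iff, and_true, false_and, or_false]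

/-- ★★ **ADDING THE CAP IS A BIJECTION ONTO THE CONFIGURATIONS OF `W` WITH THE CAP PROFILE**: for `ξ ⊆ H_G`, `ξ ∪ N ∈ W^{W}_z(s)` iff `ξ ∈ W^{D}_z(s)`.
[cite: KhristoforovSmirnov2021, §1.2 (arXiv v1 pp. 2–3); §2 Definition 3 (p. 4)] -/
theorem union_mem_TXb_iff₀ {ξ : Finset (Sym2 (Site 2))} (hξ : ξ ⊆ hBonds D) {v : HexVertex} {i : Fin 3} (hz : side v i ∈ hBonds D) {s : HexVertex}
    (hs : s ∈ triFacesTouching D.verts) : ξ ∪ N ∈ TXb W v i s ↔ ξ ∈ TXb D v i s := by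
  rw [mem_TXb_iff, mem_TXb_iff, T.parityIs_union_iff₀ C hξ hs]
  refine and_congr ⟨fun h1 b hb => ?_, fun h1 b hb => ?_⟩ Iff.rfl
  · exact Finset.mem_erase.2 ⟨(Finset.mem_erase.1 (h1 (Finset.mem_union_left _ hb))).1, hξ hb⟩
  · rcases Finset.mem_union.1 hb with hb | hb
    · exact Finset.mem_erase.2 ⟨(Finset.mem_erase.1 (h1 hb)).1, T.hBonds_subset (hξ hb)⟩
    · refine Finset.mem_erase.2 ⟨?_, T.profile_subset_hBondsW C.profile hb⟩
      rintro rfl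
      exact T.not_mem_profile_of_mem_hBonds C.profile hz hb

omit C in
/-- the link relation of the cap insertion, with the two new corners named `ja`, `jb`. [cite: PearceRittenbergDeGierNienhuis2002, §2 (monoid: the cup–cap)] -/
theorem mem_capIns_iff' (q : Pat₀ nm) {u w : Fin (nm + 1 + 1)} : (u, w) ∈ (q.capIns j).1.1.2 ↔
    (u = ja ∧ w = jb) ∨ (u = jb ∧ w = ja) ∨ ∃ a b : Fin nm, (a, b) ∈ q.1.1.2 ∧ u = skip j a ∧ w = skip j b := by
  rw [Pat₀.mem_capIns_iff]
  rcases T.pair with ⟨e1, e2⟩ | ⟨e1, e2⟩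
  · rw [e1, e2]
  · rw [e1, e2, or_left_comm]

/-- ★★★ **THE PARTNER AFTER ADDING THE CAP IS THE LIFTED PARTNER** `skip j q₀` **OF THE CAP-INSERTED PATTERN**: if `ξ ∈ W^{D}_z(s)` has the outermost pattern `q` then `ξ ∪ N` lies in
the class `[z ↔ u_c]` of `W` iff `c` is the partner of `q.capIns j` (the cap strand `a ~ b` carries no odd face).
[cite: KhristoforovSmirnov2021, §2 Definition 3 (arXiv v1 p. 4); PearceRittenbergDeGierNienhuis2002, §2 (monoid: the cup–cap)] -/
theorem inClassX_union_iff₀ {v : HexVertex} (hv : AllSides D v) {i : Fin 3} {s : HexVertex} (hs₂ : s ∈ ({v, oppFace v i} : Finset HexVertex))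
    (hs : s ∈ triFacesTouching D.verts) {ξ : Finset (Sym2 (Site 2))} (hξ : ξ ∈ TXb D v i s) (q : Pat₀ nm)
    (hcl : InClassX D (faceVertex v (i + 1)) (faceVertex v (i + 2)) s q.1.1.1 ξ) (c : Fin (nm + 1 + 1)) :
    InClassX W (faceVertex v (i + 1)) (faceVertex v (i + 2)) s c (ξ ∪ N) ↔ (q.capIns j).1.1.1 = c := by
  have hξD : ξ ⊆ hBonds D := fun b hb => (Finset.mem_erase.1 (((mem_TXb_iff (D := D) v i s ξ).1 hξ).1 hb)).2
  have hz : side v i ∈ hBonds D := hv i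
  have hmem' : ξ ∪ N ∈ TXb W v i s := (T.union_mem_TXb_iff₀ C hξD hz hs).2 hξ
  rw [hbK_inClassX_iff, Pat₀.capIns_partner, and_iff_right (show ξ ∪ N ∈ loopSpaceX W (faceVertex v (i + 1)) (faceVertex v (i + 2)) s from hmem')]
  rcases T.eq_ja_or_jb_or_skip c with rfl | rfl | ⟨c', rfl⟩
  · rw [T.yc_a]
    exact iff_of_false (fun h => T.not_reachable_a_union₀ C hξD hs h.symm) (T.skip_ne_ja _)
  · rw [T.yc_b]
    exact iff_of_false (fun h => T.not_reachable_b_union₀ C hξD hs h.symm) (T.skip_ne_jb _)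
  · rw [T.yc_skip, T.reachable_union_iff₀ C hξD hs (yc_mem_touching D c')]
    constructor
    · intro h1
      have hx : InClassX D (faceVertex v (i + 1)) (faceVertex v (i + 2)) s c' ξ :=
        (hbK_inClassX_iff _ _ _ _ _).2 ⟨((hbK_inClassX_iff _ _ _ _ _).1 hcl).1, h1⟩
      rw [(existsUnique_inClassX D hv i hs₂ hξ).unique hcl hx]
    · intro e
      rw [← skip_injective j e]
      exact ((hbK_inClassX_iff _ _ _ _ _).1 hcl).2

/-- ★★★ **THE LINK RELATION AFTER ADDING THE CAP IS THAT OF THE CAP-INSERTED PATTERN** (`a ~ b`, the old corners as before).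
[cite: KhristoforovSmirnov2021, §1.2 (arXiv v1 p. 2: the link pattern `IP(ξ)`); PearceRittenbergDeGierNienhuis2002, §2 (monoid: the cup–cap)] -/
theorem linkRel_union_eq₀ {v : HexVertex} {i : Fin 3} {s : HexVertex} {ξ : Finset (Sym2 (Site 2))} (hξ : ξ ∈ TXb D v i s) (q : Pat₀ nm)
    (hL : linkRel D ξ = q.1.1.2) : linkRel W (ξ ∪ N) = (q.capIns j).1.1.2 := by
  have hξD : ξ ⊆ hBonds D := fun b hb => (Finset.mem_erase.1 (((mem_TXb_iff (D := D) v i s ξ).1 hξ).1 hb)).2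
  ext ⟨u, w⟩
  rw [mem_linkRel, xiLinked_iff_reachable, T.mem_capIns_iff' q]
  rcases T.eq_ja_or_jb_or_skip u with rfl | rfl | ⟨a', rfl⟩ <;> rcases T.eq_ja_or_jb_or_skip w with e | e | ⟨b', e⟩ <;> (try subst e)
  · refine iff_of_false (fun h => h.1 rfl) ?_
    rintro (⟨-, h⟩ | ⟨h, -⟩ | ⟨a, b, -, h, -⟩)
    · exact T.ja_ne_jb h
    · exact T.ja_ne_jb h
    · exact T.skip_ne_ja a h.symm
  · rw [T.yc_a, T.yc_b]
    exact iff_of_true ⟨T.ja_ne_jb, T.reachable_a_b_union₀ C hξD⟩ (Or.inl ⟨rfl, rfl⟩)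
  · rw [T.yc_a, T.yc_skip]
    refine iff_of_false (fun h => T.not_reachable_a_union₀ C hξD (yc_mem_touching D b') h.2) ?_
    rintro (⟨-, h⟩ | ⟨h, -⟩ | ⟨a, b, -, h, -⟩)
    · exact T.skip_ne_jb b' h
    · exact T.ja_ne_jb h
    · exact T.skip_ne_ja a h.symm
  · rw [T.yc_a, T.yc_b]
    exact iff_of_true ⟨T.ja_ne_jb.symm, (T.reachable_a_b_union₀ C hξD).symm⟩ (Or.inr (Or.inl ⟨rfl, rfl⟩))
  · refine iff_of_false (fun h => h.1 rfl) ?_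
    rintro (⟨h, -⟩ | ⟨-, h⟩ | ⟨a, b, -, h, -⟩)
    · exact T.ja_ne_jb h.symm
    · exact T.ja_ne_jb h.symm
    · exact T.skip_ne_jb a h.symm
  · rw [T.yc_b, T.yc_skip]
    refine iff_of_false (fun h => T.not_reachable_b_union₀ C hξD (yc_mem_touching D b') h.2) ?_
    rintro (⟨h, -⟩ | ⟨-, h⟩ | ⟨a, b, -, h, -⟩)
    · exact T.ja_ne_jb h.symm
    · exact T.skip_ne_ja b' h
    · exact T.skip_ne_jb a h.symm
  · rw [T.yc_a, T.yc_skip]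
    refine iff_of_false (fun h => T.not_reachable_a_union₀ C hξD (yc_mem_touching D a') h.2.symm) ?_
    rintro (⟨h, -⟩ | ⟨h, -⟩ | ⟨a, b, -, -, h⟩)
    · exact T.skip_ne_ja a' h
    · exact T.skip_ne_jb a' h
    · exact T.skip_ne_ja b h.symm
  · rw [T.yc_b, T.yc_skip]
    refine iff_of_false (fun h => T.not_reachable_b_union₀ C hξD (yc_mem_touching D a') h.2.symm) ?_
    rintro (⟨h, -⟩ | ⟨h, -⟩ | ⟨a, b, -, -, h⟩)
    · exact T.skip_ne_ja a' h
    · exact T.skip_ne_jb a' h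
    · exact T.skip_ne_jb b h.symm
  · rw [T.yc_skip, T.yc_skip]
    by_cases hab : a' = b'
    · subst hab
      refine iff_of_false (fun h => h.1 rfl) ?_
      rintro (⟨h, -⟩ | ⟨h, -⟩ | ⟨a, b, hab, ha, hb⟩)
      · exact T.skip_ne_ja a' h
      · exact T.skip_ne_jb a' h
      · rw [← skip_injective j ha, ← skip_injective j hb, ← hL, mem_linkRel] at hab
        exact hab.1 rfl
    · have key : (sideGraph ξ).Reachable (yc D a') (yc D b') ↔ (a', b') ∈ q.1.1.2 := by
        rw [← hL, mem_linkRel, xiLinked_iff_reachable]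
        exact ⟨fun h => ⟨hab, h⟩, fun h => h.2⟩
      rw [T.reachable_union_iff₀ C hξD (yc_mem_touching D a') (yc_mem_touching D b'), key]
      constructor
      · exact fun h => Or.inr (Or.inr ⟨a', b', h.2, rfl, rfl⟩)
      · rintro (⟨h, -⟩ | ⟨h, -⟩ | ⟨a, b, h, ha, hb⟩)
        · exact absurd h (T.skip_ne_ja a')
        · exact absurd h (T.skip_ne_jb a')
        · exact ⟨(skip_injective j).ne hab, by rw [skip_injective j ha, skip_injective j hb]; exact h⟩

/-- **restriction (cap case)**: a configuration of `W` avoiding `nb¹_0` and `I` is `ξ ∪ N` with `ξ` its `H_G`-part. [cite: KhristoforovSmirnov2021, §1.2 (arXiv v1 p. 2)] -/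
theorem eq_filter_union₀ {v : HexVertex} {i : Fin 3} {s : HexVertex} (hs : s ∈ triFacesTouching D.verts) {ζ : Finset (Sym2 (Site 2))} (hζ : ζ ∈ TXb W v i s)
    (hx : nbond h₁ r₁ ∉ ζ) (hy : nbond h₁ (r₁ + (m₁ + 1)) ∉ ζ) :
    ζ = ζ.filter (fun b => b ∈ hBonds D) ∪ N ∧ ζ.filter (fun b => b ∈ hBonds D) ⊆ hBonds D := by
  have e : ζ.filter (fun b => b ∉ hBonds D) = N := (T.isProfile_filter hs hζ).eq_of_iff C.profile T.m₁_le (iff_false_intro hx) (iff_false_intro hy)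
  rw [← e]
  exact ⟨eq_filter_union_filter ζ, fun b hb => (Finset.mem_filter.1 hb).2⟩

/-- the `H_G`-part of `ξ ∪ N` is `ξ` (cap case). [cite: KhristoforovSmirnov2021, §1.2 (arXiv v1 p. 2)] -/
theorem filter_union_eq₀ {ξ : Finset (Sym2 (Site 2))} (hξ : ξ ⊆ hBonds D) : (ξ ∪ N).filter (fun b => b ∈ hBonds D) = ξ := by
  classical
  ext b
  rw [Finset.mem_filter, Finset.mem_union]
  constructor
  · rintro ⟨hb | hb, hb₁⟩
    · exact hb
    · exact absurd hb (T.not_mem_profile_of_mem_hBonds C.profile hb₁)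
  · exact fun hb => ⟨Or.inl hb, hξ hb⟩

/-- `nb¹_0 ∉ ξ ∪ N` and `I ∉ ξ ∪ N` for `ξ ⊆ H_G` (cap case). [cite: KhristoforovSmirnov2021, §1.2 (arXiv v1 p. 2)] -/
theorem bits_union₀ {ξ : Finset (Sym2 (Site 2))} (hξ : ξ ⊆ hBonds D) : nbond h₁ r₁ ∉ ξ ∪ N ∧ nbond h₁ (r₁ + (m₁ + 1)) ∉ ξ ∪ N := by
  have h0 := C.profile.mem₁ 0 (Fin.zero_le _)
  have h0' := T.new₁_not_mem_hBonds (k := 0) (by have := T.m₁_le; omega)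
  rw [add_zero] at h0 h0'
  rw [Finset.mem_union, Finset.mem_union, h0, C.profile.memI]
  constructor
  · rintro (h | h)
    · exact h0' (hξ h)
    · exact h.2 (Fin.zero_le _)
  · rintro (h | h)
    · exact T.I_not_mem_hBonds (hξ h)
    · exact h

end Cap

end TwoCellData

end Profile

end Literature.Probability.Percolation.MarkedLoops
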